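import Summits.CriticalPhenomena.PercolationContinuityZ3.Theorems.Transplant.CayleyMilnorWords
import Summits.CriticalPhenomena.PercolationContinuityZ3.Theorems.Transplant.CayleyMilnorKernel
import Literature.Barriers.CriticalPhenomena.SubexponentialGrowthZdNoPercolationProofs
import HarnessLib

/-!
# A free submonoid of rank two forces exponential growth of EVERY Cayley graph, hence `θ(p_c) = 0` unconditionally (Hutchcroft) — the certificate
# by which a concrete group enters the exponential-growth row of the C3 class map

builds on p205010 (kernel theorem, internal audit signed; external expert review pending) — nothing in this file uses p205010; unconditional, no node.
Lane `prim-bschramm`, seat `prim-bschramm-p4` gen 22 (PART C3 of `P4-GENERAL.md` §44).  Helper file (`--supports stmt-CriticalPhenomena-4575 --as helper`).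

THE POINT.  The class map's row "exponential growth: DONE (Hutchcroft 2016, PROVED in the tree)" is entered, for a concrete finitely generated group, by a
growth certificate.  The standard one (Rosenblatt 1974 / Chou 1980: every finitely generated solvable group that is not virtually nilpotent — indeed
every f.g. group that is not virtually nilpotent and has no free subsemigroup is "supramenable"-exotic — contains a FREE SUBSEMIGROUP on two
generators; e.g. `x ↦ 2x`, `x ↦ 2x + 1` in `BS(1,2)`, `t`, `ta` in the lamplighter group) is made kernel here: **`FreePair.hasExponentialGrowth` — if the
positive words in `u, v ∈ Γ` are pairwise distinct (`w ↦ ∏ w` injective on `List Bool`), then `Cay(Γ; S)` has exponential growth for EVERY finite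
generating set `S`** (the `2^m` words of length `m` are distinct elements of `S`-length `≤ mR`, `R = max(|u|_S, |v|_S)`; then
`Milnor.hasExponentialGrowth_of_two_pow_le`), whence **`FreePair.criticalContinuity : θ_g(p_c(Cay(Γ; S))) = 0` at every vertex, for every `S`,
UNCONDITIONALLY** (tree `Hutchcroft2016_noPercolationAtCriticality_holds`); `p_c < 1` there is gen 22's `ExpGrowth.criticalProb_lt_one_of_hasExponentialGrowth`
(file `ExpGrowthCriticalProbLtOne`), so such groups are non-vacuous kernel instances of Conjecture 4 for every generating set.
[cite: MilnorSolvableGrowth1968, p. 447 (free semigroup ⟹ exponential growth, Lemma 3/4)] [cite: Hutchcroft2016, Thm. 1]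
[cite: LyonsPeres2016, §7.4 Thm. 7.20] [cite: BenjaminiSchramm1996, Conj. 4]
-/

noncomputable section

namespace Summit.CriticalPhenomena.PercolationContinuityZ3.Theorems.Transplant
open SimpleGraph Literature.Probability.LatticeModels Literature.Probability.Percolation
open Literature.Barriers.CriticalPhenomena
open scoped Classical

namespace FreePair

variable {Γ : Type} [Group Γ] (S : Finset Γ)

/-- A positive word in `u, v` of length `m` (coded by a list of Booleans) has `S`-length `≤ m·R` if `u, v` have `S`-length `≤ R`. [folklore] -/
theorem wordProd_mem_graphBall {u v : Γ} {R : ℕ} (hu : u ∈ graphBall (mulCayley (↑S : Set Γ)) 1 R) (hv : v ∈ graphBall (mulCayley (↑S : Set Γ)) 1 R) :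
    ∀ w : List Bool, (w.map fun b => if b then u else v).prod ∈ graphBall (mulCayley (↑S : Set Γ)) 1 (w.length * R)
  | [] => by rw [List.map_nil, List.prod_nil, List.length_nil, zero_mul]; exact mem_graphBall_self _ _ _
  | b :: w => by
    rw [List.map_cons, List.prod_cons, List.length_cons, Nat.succ_mul, add_comm]
    refine Milnor.mul_mem_graphBall S ?_ (wordProd_mem_graphBall hu hv w)
    cases b
    · exact hv
    · exact hu

/-- **A free pair fills balls exponentially**: `2^m ≤ |B(x, mR)|` at every vertex. [cite: MilnorSolvableGrowth1968, p. 447] -/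
theorem two_pow_le_ballVolume {u v : Γ} (hfree : Function.Injective fun w : List Bool => (w.map fun b => if b then u else v).prod) {R : ℕ}
    (hu : u ∈ graphBall (mulCayley (↑S : Set Γ)) 1 R) (hv : v ∈ graphBall (mulCayley (↑S : Set Γ)) 1 R) (x : Γ) (m : ℕ) :
    2 ^ m ≤ ballVolume (mulCayley (↑S : Set Γ)) x (m * R) := by
  set F : (Fin m → Bool) → Γ := fun ε => x * ((List.ofFn ε).map fun b => if b then u else v).prod with hF
  have hFinj : Function.Injective F := by
    intro ε δ h
    have h1 := mul_left_cancel h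
    exact List.ofFn_injective (hfree h1)
  have hsub : Set.range F ⊆ graphBall (mulCayley (↑S : Set Γ)) x (m * R) := by
    rintro _ ⟨ε, rfl⟩
    have h := wordProd_mem_graphBall S hu hv (List.ofFn ε)
    rw [List.length_ofFn] at h
    exact Milnor.mul_mem_graphBall_left S x h
  calc 2 ^ m = (Set.range F).ncard := by
        rw [← Set.image_univ, Set.ncard_image_of_injective _ hFinj, Set.ncard_univ, Nat.card_eq_fintype_card]
        simp
    _ ≤ ballVolume (mulCayley (↑S : Set Γ)) x (m * R) := Set.ncard_le_ncard hsub (graphBall_finite _ x _)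

/-- **THEOREM (unconditional): a free pair forces exponential growth of every Cayley graph.**  If the positive words in `u, v` are pairwise distinct
elements of `Γ = ⟨S⟩` (`S` finite, arbitrary), then `Cay(Γ; S)` has exponential growth. [cite: MilnorSolvableGrowth1968, p. 447] [cite: LyonsPeres2016, §7.4] -/
theorem hasExponentialGrowth (hS : Subgroup.closure (S : Set Γ) = ⊤) {u v : Γ}
    (hfree : Function.Injective fun w : List Bool => (w.map fun b => if b then u else v).prod) : HasExponentialGrowth (mulCayley (↑S : Set Γ)) := by
  obtain ⟨ru, hu⟩ := Milnor.exists_mem_graphBall S hS u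
  obtain ⟨rv, hv⟩ := Milnor.exists_mem_graphBall S hS v
  set R : ℕ := max ru rv + 1 with hR
  have hu' : u ∈ graphBall (mulCayley (↑S : Set Γ)) 1 R := graphBall_mono _ _ (by omega) hu
  have hv' : v ∈ graphBall (mulCayley (↑S : Set Γ)) 1 R := graphBall_mono _ _ (by omega) hv
  exact Milnor.hasExponentialGrowth_of_two_pow_le _ (by omega) fun x m => two_pow_le_ballVolume S hfree hu' hv' x m

/-- **THEOREM (unconditional, kernel): a free pair forces `θ_g(p_c) = 0` on EVERY Cayley graph of the group** (exponential growth + Hutchcroft 2016,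
Thm. 1, PROVED in the tree). [cite: Hutchcroft2016, Thm. 1] [cite: BenjaminiSchramm1996, Conj. 4; §2 (Cayley graphs)] -/
theorem criticalContinuity (hS : Subgroup.closure (S : Set Γ) = ⊤) {u v : Γ}
    (hfree : Function.Injective fun w : List Bool => (w.map fun b => if b then u else v).prod) (g : Γ) :
    theta (mulCayley (↑S : Set Γ)) g (criticalProbIOf (mulCayley (↑S : Set Γ)) g) = 0 :=
  Hutchcroft2016_noPercolationAtCriticality_holds _ (CayleyScaled.connected_mulCayley_of_closure S hS)
    (CayleyScaled.isQuasiTransitive_mulCayley S) (hasExponentialGrowth S hS hfree) g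

end FreePair

end Summit.CriticalPhenomena.PercolationContinuityZ3.Theorems.Transplant
end
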